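import Summits.BirchSwinnertonDyer.BirchSwinnertonDyer.Theorems.PrintCFramBottomClassIndexLawFiveLeFlipRungTwoFlipWeights
import Literature.NumberTheory.EllipticCurves.HalfIntegralWeightTranslation
import Mathlib.RingTheory.IntegralClosure.IsIntegral.Basic
import HarnessLib

/-!
# Crux `PrintCFram.BottomClassIndexLawFiveLe` (stmt-BirchSwinnertonDyer-20372), line `eisenstein-resource-bdp-line` (registry v29/v30a `stub_flipRungTwo`):
# THE 2-ADIC FLIPPED-CUSP RUNG, modular assembly piece (A2b) — THE FLIP WEIGHT OF THE CLASS CUT IS A UNIT ON THE LIVE CLASSES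
# (cell `bsd-print-cfram`, width seat `bsd-line-cfram-p1-w7` g9; THEOREMS ONLY, `--supports` 20372 `--as helper`; BSD is not proved by any of this)

HONEST FRAMING. Finite identities in `ℂ`; nothing about BSD; no registered stub is closed. (A2) `…FlipRungTwoBracketMain.bracket_coeff_eq_flipWeight_mul`
reads the bracket of the Katz vehicle at the flipped cusp as `8^{−(k+1)}·W_c(n)·b(n)` off the junk, with the RAW flip weight
`W_c(n) = Σ_{j∈{1,3,5,7}} ⅛ζ₈^{−cj}·ψ(8+Mj)·(ε_{8+Mj}⁻¹ J(8M | 8+Mj))^{2k+1}·e(−jn/8)`. Here, for the trivial character `ψ = 1` at level `4M` (`M` odd):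
by P1b (`classWeight_mul_translatePhase`, `flipWeightSum_multiplier`) and T6a, `W_c(n) = (J(2|M)/8)·T` with `T ∈ {±4ζ₈⁷, ±4ζ₈}` EXACTLY on the live
classes `n + c ≡ 2k + 1 (mod 4)` — so `W_c(n)` has an ALGEBRAIC-INTEGER inverse `v = ±2·J(2|M)·ζ₈^{1 or 7}` there. This is the unit-division step of
`jmlTwo_six_of_facts` (no exceptional prime at `2`: crux notes w7g8-T6 §1d).

* §1 `coprime_eight_add_mul`, `one_apply_eight_add_mul` (`ψ = 1` at `d_j`), cast bookkeeping, `isIntegral_exp_two_pi_I_div_eight`;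
* §2 `flipWeightTable_live` — on the live classes the table value is `s·4·ζ₈^e`, `s = ±1`, `e ∈ {1, 7}`;
* §3 **`exists_isIntegral_flipWeight_mul_eq_one`** — `∃ v, IsIntegral ℤ v ∧ W_c(n)·v = 1`.

No definitions, no named facts, no `sorry`. beyond-print theorem: NO. References: [Shimura1973HalfIntegral] §1 (1.10); crux notes w7g8-T6 §1d, §3b.
-/

set_option autoImplicit false
-- summit-side namespace `Summit.BirchSwinnertonDyer.BirchSwinnertonDyer.…` (single-conjunct summit, D-0017 layout)
set_option linter.dupNamespace false

noncomputable section

open Complex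
open scoped NumberTheorySymbols Real
open Literature.NumberTheory.EllipticCurves.ModularForms (thetaEps)
open Literature.NumberTheory.EllipticCurves (Tunnell1983.int_gcd_two_eq_one Tunnell1983.zeta8)

namespace Summit.BirchSwinnertonDyer.BirchSwinnertonDyer.Theorems.PrintCFram.FlipRung

/-! ## §1 Bookkeeping: the trivial character at `d_j`, casts, integrality of `ζ₈` -/

/-- `8 + Mj` is prime to `4M` for `M`, `j` odd. [folklore] -/
theorem coprime_eight_add_mul {M j : ℕ} (hM : Odd M) (hj : Odd j) : Nat.Coprime (8 + M * j) (4 * M) := by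
  have h2M : Nat.Coprime 2 M := (Nat.Prime.coprime_iff_not_dvd Nat.prime_two).mpr (by
    intro h; exact (Nat.not_even_iff_odd.mpr hM) (even_iff_two_dvd.mpr h))
  have hodd : Odd (8 + M * j) := by
    have : Even 8 := ⟨4, rfl⟩
    exact this.add_odd (hM.mul hj)
  have h2d : Nat.Coprime 2 (8 + M * j) := (Nat.Prime.coprime_iff_not_dvd Nat.prime_two).mpr (by
    intro h; exact (Nat.not_even_iff_odd.mpr hodd) (even_iff_two_dvd.mpr h))
  refine Nat.Coprime.mul_right ?_ ?_
  · rw [show (4 : ℕ) = 2 ^ 2 by norm_num]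
    exact (Nat.Coprime.pow_left 2 h2d).symm
  · rw [Nat.coprime_add_mul_left_left, show (8 : ℕ) = 2 ^ 3 by norm_num]
    exact Nat.Coprime.pow_left 3 h2M

/-- The trivial character at T6b's `d_j = 8 + Mj` (`M`, `j` odd) is `1`. [folklore] -/
theorem one_apply_eight_add_mul {M : ℕ} (hM : Odd M) {j : ℕ} (hj : Odd j) :
    (1 : DirichletCharacter ℂ (4 * M)) (((8 + (M : ℤ) * (j : ℤ) : ℤ)) : ZMod (4 * M)) = 1 := by
  have hcast : (((8 + (M : ℤ) * (j : ℤ) : ℤ)) : ZMod (4 * M)) = ((8 + M * j : ℕ) : ZMod (4 * M)) := by push_cast; ring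
  rw [hcast]
  exact MulChar.one_apply ((ZMod.isUnit_iff_coprime _ _).mpr (coprime_eight_add_mul hM hj))

/-- Cast bookkeeping between P1's `ℤ`-spelling and P1b's `ℕ`-spelling of `d_j = 8 + Mj`. [folklore] -/
theorem multiplier_cast_eq (M j : ℕ) :
    (thetaEps (8 + (M : ℤ) * (j : ℤ)))⁻¹ * (J(8 * (M : ℤ) | (8 + (M : ℤ) * (j : ℤ)).natAbs) : ℂ) =
      (thetaEps ((8 + M * j : ℕ) : ℤ))⁻¹ * (J(8 * M | (8 + M * j : ℕ)) : ℂ) := by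
  have h1 : (8 + (M : ℤ) * (j : ℤ) : ℤ) = ((8 + M * j : ℕ) : ℤ) := by push_cast; ring
  rw [h1, Int.natAbs_natCast]

/-- `ζ₈ = e(1/8)` is an algebraic integer (`ζ₈⁸ = 1`). [folklore] -/
theorem isIntegral_exp_two_pi_I_div_eight : IsIntegral ℤ (cexp (2 * π * I / 8)) :=
  IsIntegral.of_pow (by norm_num : 0 < 8) (by rw [exp_two_pi_I_div_eight_pow_eight]; exact isIntegral_one)

/-! ## §2 The table value on the live classes -/

/-- **On the live classes the weight table is `±4ζ₈^{1 or 7}`.** With `σ = (−1)^k·(−1)^{[M ≡ 3 (4)]}` and `t = c + n ≡ 2k+1 (mod 4)` (`M` odd):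
if `σ = 1` then `Mt ≡ 1, 5 (mod 8)` and the `F₁`-table gives `±4z⁷`; if `σ = −1` then `Mt ≡ 3, 7 (mod 8)` and the `F_{χ₄}`-table gives `∓4z`.
[folklore] -/
theorem flipWeightTable_live {M : ℕ} (hM : Odd M) (k : ℕ) (z : ℂ) {c n : ℕ} (hlive : (n + c) % 4 = (2 * k + 1) % 4) :
    ∃ (s : ℤ) (e : ℕ), (s = 1 ∨ s = -1) ∧ (e = 1 ∨ e = 7) ∧
      (if (-1 : ℂ) ^ k * (if M % 4 = 3 then -1 else 1) = 1 then
          (if M * (c + n) % 8 = 1 then 4 * z ^ 7 else if M * (c + n) % 8 = 5 then -4 * z ^ 7 else 0)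
        else (if M * (c + n) % 8 = 3 then -4 * z else if M * (c + n) % 8 = 7 then 4 * z else 0)) = (s : ℂ) * 4 * z ^ e := by
  have hM4 : M % 4 = 1 ∨ M % 4 = 3 := by have := Nat.odd_iff.mp hM; omega
  have h11 : ((-1 : ℂ) = 1) ↔ False := by norm_num
  rcases Nat.even_or_odd k with hk | hk
  · have hk1 : (-1 : ℂ) ^ k = 1 := hk.neg_one_pow
    have hk2 : (2 * k + 1) % 4 = 1 := by obtain ⟨r, rfl⟩ := hk; omega
    rcases hM4 with h4 | h4
    · -- σ = 1, M ≡ 1: Mt ≡ t ≡ 1 (mod 4)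
      have ht : M * (c + n) % 8 = 1 ∨ M * (c + n) % 8 = 5 := by
        have : M * (c + n) % 4 = 1 := by rw [Nat.mul_mod, h4]; omega
        omega
      rcases ht with h8 | h8
      · exact ⟨1, 7, Or.inl rfl, Or.inr rfl, by simp [hk1, h4, h8]⟩
      · exact ⟨-1, 7, Or.inr rfl, Or.inr rfl, by simp [hk1, h4, h8]⟩
    · -- σ = −1, M ≡ 3: Mt ≡ 3t ≡ 3 (mod 4)
      have ht : M * (c + n) % 8 = 3 ∨ M * (c + n) % 8 = 7 := by
        have : M * (c + n) % 4 = 3 := by rw [Nat.mul_mod, h4]; omega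
        omega
      rcases ht with h8 | h8
      · exact ⟨-1, 1, Or.inr rfl, Or.inl rfl, by simp [hk1, h4, h8, h11]⟩
      · exact ⟨1, 1, Or.inl rfl, Or.inl rfl, by simp [hk1, h4, h8, h11]⟩
  · have hk1 : (-1 : ℂ) ^ k = -1 := hk.neg_one_pow
    have hk2 : (2 * k + 1) % 4 = 3 := by obtain ⟨r, rfl⟩ := hk; omega
    rcases hM4 with h4 | h4
    · -- σ = −1, M ≡ 1: Mt ≡ t ≡ 3 (mod 4)
      have ht : M * (c + n) % 8 = 3 ∨ M * (c + n) % 8 = 7 := by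
        have : M * (c + n) % 4 = 3 := by rw [Nat.mul_mod, h4]; omega
        omega
      rcases ht with h8 | h8
      · exact ⟨-1, 1, Or.inr rfl, Or.inl rfl, by simp [hk1, h4, h8, h11]⟩
      · exact ⟨1, 1, Or.inl rfl, Or.inl rfl, by simp [hk1, h4, h8, h11]⟩
    · -- σ = 1, M ≡ 3: Mt ≡ 3·3 ≡ 1 (mod 4)
      have ht : M * (c + n) % 8 = 1 ∨ M * (c + n) % 8 = 5 := by
        have : M * (c + n) % 4 = 1 := by rw [Nat.mul_mod, h4]; omega
        omega
      rcases ht with h8 | h8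
      · exact ⟨1, 7, Or.inl rfl, Or.inr rfl, by simp [hk1, h4, h8]⟩
      · exact ⟨-1, 7, Or.inr rfl, Or.inr rfl, by simp [hk1, h4, h8]⟩

/-! ## §3 The flip weight of the class cut is a unit on the live classes -/

/-- **THE FLIP WEIGHT IS A UNIT ON THE LIVE CLASSES.** For odd `M`, `k c n : ℕ` with `n + c ≡ 2k + 1 (mod 4)`, the raw flip weight of the class cut
`P_c` at the 2-adic flipped cusp for the TRIVIAL character at level `4M`,
`W_c(n) = Σ_{j∈{1,3,5,7}} ⅛(ζ₈^{cj})⁻¹·1(8+Mj)·(ε_{8+Mj}⁻¹ J(8M | 8+Mj))^{2k+1}·e(−jn/8)`, has an algebraic-integer inverse: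
`∃ v, IsIntegral ℤ v ∧ W_c(n)·v = 1` (`W_c(n) = (J(2|M)/8)·(±4ζ₈^{e})`, `v = ±2 J(2|M) ζ₈^{8−e}`). [cite: Shimura1973HalfIntegral, §1 (1.10), Prop. 1.5] -/
theorem exists_isIntegral_flipWeight_mul_eq_one {M : ℕ} (hM : Odd M) (k c n : ℕ) (hlive : (n + c) % 4 = (2 * k + 1) % 4) :
    ∃ v : ℂ, IsIntegral ℤ v ∧
      (∑ j ∈ ({1, 3, 5, 7} : Finset ℕ), (8 : ℂ)⁻¹ * (Tunnell1983.zeta8 ^ (c * j))⁻¹ *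
        ((1 : DirichletCharacter ℂ (4 * M)) (((8 + (M : ℤ) * (j : ℤ) : ℤ)) : ZMod (4 * M)) *
          ((thetaEps (8 + (M : ℤ) * (j : ℤ)))⁻¹ * (J(8 * (M : ℤ) | (8 + (M : ℤ) * (j : ℤ)).natAbs) : ℂ)) ^ (2 * k + 1)) *
        cexp (-(2 * π * I * ((j * n : ℕ) : ℂ) / 8))) * v = 1 := by
  set Z : ℂ := cexp (2 * π * I / 8) with hZ
  have hZζ : Tunnell1983.zeta8 = Z := rfl
  have hz2 : Z ^ 2 = I := exp_two_pi_I_div_eight_sq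
  have hz8 : Z ^ 8 = 1 := exp_two_pi_I_div_eight_pow_eight
  have hodd : ∀ j ∈ ({1, 3, 5, 7} : Finset ℕ), Odd j := by
    intro j hj
    simp only [Finset.mem_insert, Finset.mem_singleton] at hj
    rcases hj with rfl | rfl | rfl | rfl <;> decide
  -- Step 1: the sum is `8⁻¹ · Σ_j X_j^{2k+1} Z^{(8 − (c+n)j % 8) % 8}`
  have hsum : ∑ j ∈ ({1, 3, 5, 7} : Finset ℕ), (8 : ℂ)⁻¹ * (Tunnell1983.zeta8 ^ (c * j))⁻¹ *
        ((1 : DirichletCharacter ℂ (4 * M)) (((8 + (M : ℤ) * (j : ℤ) : ℤ)) : ZMod (4 * M)) *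
          ((thetaEps (8 + (M : ℤ) * (j : ℤ)))⁻¹ * (J(8 * (M : ℤ) | (8 + (M : ℤ) * (j : ℤ)).natAbs) : ℂ)) ^ (2 * k + 1)) *
        cexp (-(2 * π * I * ((j * n : ℕ) : ℂ) / 8)) =
      (8 : ℂ)⁻¹ * ∑ j ∈ ({1, 3, 5, 7} : Finset ℕ),
        ((thetaEps ((8 + M * j : ℕ) : ℤ))⁻¹ * (J(8 * M | (8 + M * j : ℕ)) : ℂ)) ^ (2 * k + 1) * Z ^ ((8 - (c + n) * j % 8) % 8) := by
    rw [Finset.mul_sum]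
    refine Finset.sum_congr rfl (fun j hj ↦ ?_)
    rw [one_apply_eight_add_mul hM (hodd j hj), one_mul, multiplier_cast_eq, hZζ, ← classWeight_mul_translatePhase c n j]
    ring
  -- Step 2: P1b's evaluation and the live table value
  rw [hsum, flipWeightSum_multiplier hM k hz2 (c + n)]
  obtain ⟨s, e, hs, he, htab⟩ := flipWeightTable_live hM k Z (c := c) (n := n) hlive
  rw [htab]
  -- Step 3: the inverse
  have hJsq : ((J(2 | M) : ℤ) : ℂ) ^ 2 = 1 := by exact_mod_cast jacobiSym.sq_one (Tunnell1983.int_gcd_two_eq_one hM)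
  have hssq : ((s : ℤ) : ℂ) ^ 2 = 1 := by rcases hs with rfl | rfl <;> norm_num
  have he8 : e ≤ 8 := by rcases he with rfl | rfl <;> norm_num
  refine ⟨((2 * s : ℤ) : ℂ) * (J(2 | M) : ℂ) * Z ^ (8 - e), ?_, ?_⟩
  · exact ((isIntegral_intCast _).mul (isIntegral_intCast _)).mul (isIntegral_exp_two_pi_I_div_eight.pow _)
  · have hZe : Z ^ e * Z ^ (8 - e) = 1 := by rw [← pow_add, Nat.add_sub_cancel' he8, hz8]
    calc (8 : ℂ)⁻¹ * ((J(2 | M) : ℂ) * ((s : ℂ) * 4 * Z ^ e)) * (((2 * s : ℤ) : ℂ) * (J(2 | M) : ℂ) * Z ^ (8 - e))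
        = (((s : ℤ) : ℂ) ^ 2) * (((J(2 | M) : ℤ) : ℂ) ^ 2) * (Z ^ e * Z ^ (8 - e)) := by push_cast; ring
      _ = 1 := by rw [hssq, hJsq, hZe]; ring

end Summit.BirchSwinnertonDyer.BirchSwinnertonDyer.Theorems.PrintCFram.FlipRung

end
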